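import Summits.Ventures.PercRepro.Night2CoreFlatFive
import Summits.Ventures.PercRepro.Night2T4C4Q5M0Z
import Summits.Ventures.PercRepro.Night2T4C5Q5M0Z
import Summits.Ventures.PercRepro.Night2T4C6Q5M0Z
import Summits.Ventures.PercRepro.Night2T4C7Q5M0Z
import Summits.Ventures.PercRepro.Night2T4C8Q5M0Z
import Summits.Ventures.PercRepro.Night2T4C9Q5M0Z
import Summits.Ventures.PercRepro.Night2T4C10Q5M0Z
import Summits.Ventures.PercRepro.Night2T4C11Q5M0Z
import Summits.Ventures.PercRepro.Night2T4C12Q5M0Z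
import Summits.Ventures.PercRepro.Night2T4C13Q5M0Z
import Summits.Ventures.PercRepro.Night2T4C14Q5M0Z
import Summits.Ventures.PercRepro.Night2T4C15Q5M0Z
import Summits.Ventures.PercRepro.Night2T4C16Q5M0Z

/-!
# PercRepro — THE TYPE-`4` LAYER OF `(7, 5)` ON THE CORE: `0 ≤ J_4(G)` on every coloop-free rank-`5` flat of a Core
matroid, from the `13` dual certificates `(5, 0)` and `f(5) ≤ 21` (night-2, gen 4)

On the core every line has `≤ 3` points (`card_le_three_of_line_of_core`); with `planes ≤ 6` (night-1's plane bound on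
the `e`-free core, or night-3's `card_le_six_of_core`; a hypothesis here) and `f(4) ≤ 10` (p2's `card_le_ten_of_core`, a
hypothesis here) a rank-`5` flat has `≤ 21` points (`card_le_twentyone_of_core_of_ten`), so its corank is `≤ 16`:
coranks `≤ 3` are demand-free (`Jq_four_nonneg_of_card_le_add_three`), coranks `4 … 16` with `m(G) = 0` are the
certificates `Jq_four_nonneg_c{d}_q5_m0` of the type-`4` profile LP on the core (`mining/night-2/g4/`; the `(5, 1)`
certificates are a staged record, not needed by the coloop-free composition).
**`Jq_four_nonneg_five_of_core_of_ten`** is the type-`4` clause of night-4's `SevenFiveLayersCoreFree` on the coloop-free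
rank-`5` flats, without the corner split.  Imports `Night2CoreFlatFive` and the `13` certificate modules.
-/
namespace PercRepro.Star

open Finset ThmH SixFour GenQ PerFlat NightThree

/-- **The type-`4` balance on every coloop-free rank-`5` flat of a Core matroid**, under `planes ≤ 6` and `f(4) ≤ 10`. -/
theorem Jq_four_nonneg_five_of_core_of_ten {γ : Type} [DecidableEq γ] {M : Matroid γ} [M.Finite] {p : ℕ}
    (hc : Core M p) (hplane : ∀ P ∈ flatsQ M 3, P.card ≤ 6) (h10 : ∀ F ∈ flatsQ M 4, F.card ≤ 10)
    {G : Finset γ} (hG : G ∈ flatsQ M 5) (hm : mTr M G = 0) : 0 ≤ Jq M G 5 4 := by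
  have hG' := mem_flatsQ.1 hG
  have hs : Simple M := simple_of_core hc
  have hline : ∀ L ∈ flatsQ M 2, L.card ≤ 3 := fun L hL => card_le_three_of_line_of_core hc hL
  have h21 := card_le_twentyone_of_core_of_ten hc h10 hG
  have hr : M.eRk (G : Set γ) = ((5 : ℕ) : ℕ∞) := hG'.2.2
  have h5 : 5 ≤ G.card := le_card_of_eRk_eq hr
  rcases Nat.lt_or_ge G.card 9 with h | h
  · exact Jq_four_nonneg_of_card_le_add_three (by norm_num) (by omega)
  obtain h9 | h10 | h11 | h12 | h13 | h14 | h15 | h16 | h17 | h18 | h19 | h20 | h21 : G.card = 9 ∨ G.card = 10 ∨ G.card = 11 ∨ G.card = 12 ∨ G.card = 13 ∨ G.card = 14 ∨ G.card = 15 ∨ G.card = 16 ∨ G.card = 17 ∨ G.card = 18 ∨ G.card = 19 ∨ G.card = 20 ∨ G.card = 21 := by omega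
  · exact Jq_four_nonneg_c4_q5_m0 hs hline hplane hG'.1 hr (by omega) hm
  · exact Jq_four_nonneg_c5_q5_m0 hs hline hplane hG'.1 hr (by omega) hm
  · exact Jq_four_nonneg_c6_q5_m0 hs hline hplane hG'.1 hr (by omega) hm
  · exact Jq_four_nonneg_c7_q5_m0 hs hline hplane hG'.1 hr (by omega) hm
  · exact Jq_four_nonneg_c8_q5_m0 hs hline hplane hG'.1 hr (by omega) hm
  · exact Jq_four_nonneg_c9_q5_m0 hs hline hplane hG'.1 hr (by omega) hm
  · exact Jq_four_nonneg_c10_q5_m0 hs hline hplane hG'.1 hr (by omega) hm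
  · exact Jq_four_nonneg_c11_q5_m0 hs hline hplane hG'.1 hr (by omega) hm
  · exact Jq_four_nonneg_c12_q5_m0 hs hline hplane hG'.1 hr (by omega) hm
  · exact Jq_four_nonneg_c13_q5_m0 hs hline hplane hG'.1 hr (by omega) hm
  · exact Jq_four_nonneg_c14_q5_m0 hs hline hplane hG'.1 hr (by omega) hm
  · exact Jq_four_nonneg_c15_q5_m0 hs hline hplane hG'.1 hr (by omega) hm
  · exact Jq_four_nonneg_c16_q5_m0 hs hline hplane hG'.1 hr (by omega) hm

end PercRepro.Star
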